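import Mathlib
import HarnessLib
import Summits.Ventures.LatticeQCDFlow.Scoring.GeometricEnvelopeBlockSumLeadingBias

/-!
# The second-moment DICHOTOMY of centred block sums under a geometric envelope: either `σ²_f = 0` and
# `E_{μ₀}[S_{s,n}²]` is bounded by ONE constant for every start, block position and block length, or
# `σ²_f > 0` and `E_{μ₀}[S_{s,n}²] → ∞` with the block length from every start

HONEST FRAMING: exact (Metropolis-corrected) sampling algorithms for lattice gauge theory;
figures of merit are autocorrelation/cost numbers at stated couplings and volumes; no
continuum-physics claim.

Venture `LatticeQCDFlow` (cell pub-lqcd), topic `Scoring`; FANOUT row 8 (`s0-cpn-nemc`, GEN-23).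
NEW WORK of the cell, not a published result; no definition is introduced; nothing is cited as a
fact.  `Scoring/GeometricEnvelopeBlockSumLeadingBias` proved, for every kernel with the sup-norm
envelope `|(kop κ)^[t] g − πg| ≤ 2 C_g A ρ^t` (`0 ≤ ρ < 1`), `π` invariant and `|f| ≤ C` measurable,
from EVERY initial law `μ₀`:
`|E_{μ₀}[S_{s,n}²] − (n σ²_f − 2 Γ_f)| ≤ K₁ ρ^s + K₂ ρ^{n+1}` with `S_{s,n} = Σ_{t<n} (f(X_{s+t}) − πf)`,
`σ²_f = ∫ f̄² dπ + 2 Σ' k, γ_{k+1}`, `Γ_f = Σ' k, (k+1) γ_{k+1}` (`γ_k = ∫ f̄ (kop κ)^[k] f̄ dπ`,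
`|Γ_f| ≤ 8 C² A ρ/(1−ρ)²`), `K₁ = 16 C² A² (1+ρ)/(1−ρ)²`, `K₂ = 16 C² A ρ/(1−ρ)²`.  Read with
`σ²_f ≥ 0` (`Scoring/GeometricEnvelopeBlockSumMoments.greenKubo_nonneg_of_envelope`) this is a
DICHOTOMY with nothing in between: if `σ²_f = 0` the second moments of ALL centred block sums are
bounded by the single constant `2|Γ_f| + K₁ + K₂ ≤ 16 C² A (A(1+ρ) + 2ρ)/(1−ρ)²`, uniformly in the
start, the block position and the block length (the chain's centred partial sums do not spread at
all); if `σ²_f > 0` they tend to infinity linearly in the block length, from every start and block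
position.  So a vanishing error bar is never a finite-sample accident of the envelope class: it is the
degenerate case, characterised in the companion file `Scoring/GreenKuboDegenerate` (the centred
observable is a one-step coboundary of the Poisson solution).  Printed counterpart NAMED ONLY: the
null-variance case of the CLT for uniformly / `V`-uniformly ergodic chains (Meyn–Tweedie, *Markov
Chains and Stochastic Stability*, §17.5, Thm 17.5.4) — nothing is cited as a fact.

## Content (envelope `(A, ρ)`, `0 ≤ ρ < 1`; `|f| ≤ C` measurable; `P_{μ₀}` the path law from `μ₀`)

* `geometricEnvelope_const_nonneg` — the envelope constant satisfies `0 ≤ A`;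
* **`chain_blockSum_sq_le_of_greenKubo_eq_zero_of_envelope`** — `σ²_f = 0 ⇒` for every `μ₀, s, n`:
  `E_{μ₀}[S_{s,n}²] ≤ 16 C² A (A (1+ρ) + 2ρ)/(1−ρ)²`;
* **`tendsto_chain_blockSum_sq_atTop_of_greenKubo_pos`** — `σ²_f > 0 ⇒ E_{μ₀}[S_{s,n}²] → ∞` (`n → ∞`),
  every `μ₀`, `s`;
* **`chain_blockSum_sq_dichotomy_of_envelope`** — exactly one of the two (`π` invariant).

NOT CLAIMED: almost-sure statements (companion file); rates beyond the stated constants; unbounded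
observables; any `A, ρ` of a concrete sampler; any number of ours.
-/

noncomputable section

namespace Summit.Ventures.LatticeQCDFlow.Scoring

open MeasureTheory ProbabilityTheory Filter Finset Preorder Literature.Probability.MarkovChains
open scoped ENNReal Topology

variable {Ω : Type*} [MeasurableSpace Ω]

section Envelope

variable {κ : Kernel Ω Ω} [IsMarkovKernel κ] {π : Measure Ω} [IsProbabilityMeasure π] {A ρ : ℝ}

omit [IsMarkovKernel κ] in
/-- The envelope constant is nonnegative (the envelope at `t = 0` for the zero observable with bound `1`). -/
theorem geometricEnvelope_const_nonneg
    (henv : ∀ (g : Ω → ℝ), Measurable g → ∀ (Cg : ℝ), (∀ x, |g x| ≤ Cg) →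
      ∀ (t : ℕ) (x : Ω), |(kop κ)^[t] g x - ∫ y, g y ∂π| ≤ 2 * Cg * (A * ρ ^ t)) : 0 ≤ A := by
  have x : Ω := Classical.choice (nonempty_of_isProbabilityMeasure π)
  have h := henv (fun _ => (0 : ℝ)) measurable_const 1 (fun _ => by simp) 0 x
  have h0 : |(kop κ)^[0] (fun _ : Ω => (0 : ℝ)) x - ∫ _y, (0 : ℝ) ∂π| = 0 := by simp
  rw [h0, pow_zero, mul_one, mul_one] at h
  linarith


/-! ### `σ²_f = 0`: one bound for every start, block position and block length -/

/-- **`σ²_f = 0 ⇒ E_{μ₀}[S_{s,n}²] ≤ 16 C² A (A(1+ρ) + 2ρ)/(1−ρ)²`** for EVERY initial law `μ₀`, block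
position `s` and block length `n` (`S_{s,n} = Σ_{t<n} (f(X_{s+t}) − πf)`; envelope `(A, ρ)`, `0 ≤ ρ < 1`,
`|f| ≤ C` measurable): in the degenerate case the centred block sums have uniformly bounded second
moments. -/
theorem chain_blockSum_sq_le_of_greenKubo_eq_zero_of_envelope
    (henv : ∀ (g : Ω → ℝ), Measurable g → ∀ (Cg : ℝ), (∀ x, |g x| ≤ Cg) →
      ∀ (t : ℕ) (x : Ω), |(kop κ)^[t] g x - ∫ y, g y ∂π| ≤ 2 * Cg * (A * ρ ^ t))
    (hρ0 : 0 ≤ ρ) (hρ1 : ρ < 1)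
    {f : Ω → ℝ} (hf : Measurable f) {C : ℝ} (hC : ∀ x, |f x| ≤ C)
    (hσ : (∫ y, (f y - ∫ z, f z ∂π) ^ 2 ∂π)
        + 2 * ∑' k, ∫ y, (f y - ∫ z, f z ∂π) * (kop κ)^[k + 1] (fun y => f y - ∫ z, f z ∂π) y ∂π
        = 0)
    (μ₀ : Measure Ω) [IsProbabilityMeasure μ₀] (s n : ℕ) :
    ∫ x, (∑ t ∈ Finset.range n, (f (x (s + t)) - ∫ z, f z ∂π)) ^ 2
        ∂(Kernel.trajMeasure (X := fun _ : ℕ => Ω) μ₀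
          (fun n : ℕ => κ.comap (fun h : (i : ↥(Finset.Iic n)) → Ω => h ⟨n, Finset.mem_Iic.2 le_rfl⟩)
            (measurable_pi_apply _)))
      ≤ 16 * C ^ 2 * A * (A * (1 + ρ) + 2 * ρ) / (1 - ρ) ^ 2 := by
  set Γ : ℝ := ∑' k : ℕ, ((k : ℝ) + 1)
      * ∫ y, (f y - ∫ z, f z ∂π) * (kop κ)^[k + 1] (fun y => f y - ∫ z, f z ∂π) y ∂π with hΓ
  have hA0 : 0 ≤ A := geometricEnvelope_const_nonneg (κ := κ) henv
  have h1ρ : 0 < 1 - ρ := sub_pos.2 hρ1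
  have hC2 : 0 ≤ C ^ 2 := sq_nonneg C
  have key := abs_chain_blockSum_sq_sub_leading_le_of_envelope μ₀ henv hρ0 hρ1 hf hC s n
  rw [hσ, ← hΓ, mul_zero, zero_sub] at key
  have k1 := (abs_sub_le_iff.1 key).1
  -- `|Γ| ≤ 8 C² A ρ/(1−ρ)²`
  have hΓb : |Γ| ≤ 8 * C ^ 2 * A * ρ / (1 - ρ) ^ 2 := by
    have h := abs_leadingBias_le_of_geometricEnvelope (κ := κ) (π := π) henv hρ0 hρ1 hf hC
    have e : (∑' k : ℕ, ((k : ℝ) + 1) * autocov κ π (fun y => f y - ∫ z, f z ∂π) (k + 1)) = Γ := by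
      rw [hΓ]; rfl
    rw [e] at h
    exact h
  have hρs : ρ ^ s ≤ 1 := pow_le_one₀ hρ0 hρ1.le
  have hρn : ρ ^ (n + 1) ≤ ρ := by
    rw [pow_succ]
    exact mul_le_of_le_one_left hρ0 (pow_le_one₀ hρ0 hρ1.le)
  have hb1 : 16 * C ^ 2 * A ^ 2 * (1 + ρ) * ρ ^ s / (1 - ρ) ^ 2
      ≤ 16 * C ^ 2 * A ^ 2 * (1 + ρ) / (1 - ρ) ^ 2 := by
    rw [div_le_div_iff_of_pos_right (by positivity)]
    have : 0 ≤ 16 * C ^ 2 * A ^ 2 * (1 + ρ) := by positivity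
    nlinarith
  have hb2 : 16 * C ^ 2 * A * ρ ^ (n + 1) / (1 - ρ) ^ 2 ≤ 16 * C ^ 2 * A * ρ / (1 - ρ) ^ 2 := by
    rw [div_le_div_iff_of_pos_right (by positivity)]
    have : 0 ≤ 16 * C ^ 2 * A := by positivity
    nlinarith
  have hΓ2 : -(2 * Γ) ≤ 2 * (8 * C ^ 2 * A * ρ / (1 - ρ) ^ 2) := by
    linarith [neg_abs_le Γ]
  have etot : 2 * (8 * C ^ 2 * A * ρ / (1 - ρ) ^ 2) + 16 * C ^ 2 * A ^ 2 * (1 + ρ) / (1 - ρ) ^ 2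
      + 16 * C ^ 2 * A * ρ / (1 - ρ) ^ 2 = 16 * C ^ 2 * A * (A * (1 + ρ) + 2 * ρ) / (1 - ρ) ^ 2 := by
    field_simp
    ring
  linarith

/-! ### `σ²_f > 0`: the second moments grow linearly; the dichotomy -/

/-- **`σ²_f > 0 ⇒ E_{μ₀}[S_{s,n}²] → ∞` as `n → ∞`**, for every initial law and every block position
(the leading-constant theorem of `Scoring/GeometricEnvelopeBlockSumLeadingBias`:
`E S² ≥ n σ²_f − 2|Γ_f| − K₁ − K₂`). -/
theorem tendsto_chain_blockSum_sq_atTop_of_greenKubo_pos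
    (henv : ∀ (g : Ω → ℝ), Measurable g → ∀ (Cg : ℝ), (∀ x, |g x| ≤ Cg) →
      ∀ (t : ℕ) (x : Ω), |(kop κ)^[t] g x - ∫ y, g y ∂π| ≤ 2 * Cg * (A * ρ ^ t))
    (hρ0 : 0 ≤ ρ) (hρ1 : ρ < 1)
    {f : Ω → ℝ} (hf : Measurable f) {C : ℝ} (hC : ∀ x, |f x| ≤ C)
    (hσ : 0 < (∫ y, (f y - ∫ z, f z ∂π) ^ 2 ∂π)
        + 2 * ∑' k, ∫ y, (f y - ∫ z, f z ∂π) * (kop κ)^[k + 1] (fun y => f y - ∫ z, f z ∂π) y ∂π)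
    (μ₀ : Measure Ω) [IsProbabilityMeasure μ₀] (s : ℕ) :
    Tendsto (fun n : ℕ => ∫ x, (∑ t ∈ Finset.range n, (f (x (s + t)) - ∫ z, f z ∂π)) ^ 2
        ∂(Kernel.trajMeasure (X := fun _ : ℕ => Ω) μ₀
          (fun n : ℕ => κ.comap (fun h : (i : ↥(Finset.Iic n)) → Ω => h ⟨n, Finset.mem_Iic.2 le_rfl⟩)
            (measurable_pi_apply _)))) atTop atTop := by
  set σ2 : ℝ := (∫ y, (f y - ∫ z, f z ∂π) ^ 2 ∂π)
      + 2 * ∑' k, ∫ y, (f y - ∫ z, f z ∂π) * (kop κ)^[k + 1] (fun y => f y - ∫ z, f z ∂π) y ∂π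
    with hσ2
  set Γ : ℝ := ∑' k : ℕ, ((k : ℝ) + 1)
      * ∫ y, (f y - ∫ z, f z ∂π) * (kop κ)^[k + 1] (fun y => f y - ∫ z, f z ∂π) y ∂π with hΓ
  set K₁ : ℝ := 16 * C ^ 2 * A ^ 2 * (1 + ρ) / (1 - ρ) ^ 2 with hK₁
  set K₂ : ℝ := 16 * C ^ 2 * A / (1 - ρ) ^ 2 with hK₂
  have hA0 : 0 ≤ A := geometricEnvelope_const_nonneg (κ := κ) henv
  have h1ρ : 0 < 1 - ρ := sub_pos.2 hρ1
  have hK₁0 : 0 ≤ K₁ := by positivity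
  have hK₂0 : 0 ≤ K₂ := by positivity
  -- lower bound `E S² ≥ n σ² − (2|Γ| + K₁ + K₂)`
  have hlow : ∀ n : ℕ, (n : ℝ) * σ2 - (2 * |Γ| + K₁ + K₂)
      ≤ ∫ x, (∑ t ∈ Finset.range n, (f (x (s + t)) - ∫ z, f z ∂π)) ^ 2
        ∂(Kernel.trajMeasure (X := fun _ : ℕ => Ω) μ₀
          (fun n : ℕ => κ.comap (fun h : (i : ↥(Finset.Iic n)) → Ω => h ⟨n, Finset.mem_Iic.2 le_rfl⟩)
            (measurable_pi_apply _))) := by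
    intro n
    have key := abs_chain_blockSum_sq_sub_leading_le_of_envelope μ₀ henv hρ0 hρ1 hf hC s n
    rw [← hσ2, ← hΓ] at key
    have k2 := (abs_sub_le_iff.1 key).2
    have hρs : ρ ^ s ≤ 1 := pow_le_one₀ hρ0 hρ1.le
    have hρn : ρ ^ (n + 1) ≤ 1 := pow_le_one₀ hρ0 hρ1.le
    have e1 : 16 * C ^ 2 * A ^ 2 * (1 + ρ) * ρ ^ s / (1 - ρ) ^ 2 = K₁ * ρ ^ s := by
      rw [hK₁]; ring
    have e2 : 16 * C ^ 2 * A * ρ ^ (n + 1) / (1 - ρ) ^ 2 = K₂ * ρ ^ (n + 1) := by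
      rw [hK₂]; ring
    rw [e1, e2] at k2
    have hb1 : K₁ * ρ ^ s ≤ K₁ := by nlinarith
    have hb2 : K₂ * ρ ^ (n + 1) ≤ K₂ := by nlinarith
    have hΓabs : -(2 * Γ) ≥ -(2 * |Γ|) := by linarith [le_abs_self Γ]
    linarith
  refine tendsto_atTop_mono hlow ?_
  have h1 : Tendsto (fun n : ℕ => (n : ℝ) * σ2) atTop atTop :=
    tendsto_natCast_atTop_atTop.atTop_mul_const hσ
  exact tendsto_atTop_add_const_right _ _ h1

/-- **THE SECOND-MOMENT DICHOTOMY OF CENTRED BLOCK SUMS UNDER THE ENVELOPE** (`π` invariant,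
`0 ≤ ρ < 1`, `|f| ≤ C` measurable): EITHER `σ²_f = 0` and the second moments of all centred block sums
are bounded by ONE constant for every initial law, block position and block length, OR `σ²_f > 0` and
they tend to infinity with the block length from every initial law and block position. -/
theorem chain_blockSum_sq_dichotomy_of_envelope (hπ : Kernel.Invariant κ π)
    (henv : ∀ (g : Ω → ℝ), Measurable g → ∀ (Cg : ℝ), (∀ x, |g x| ≤ Cg) →
      ∀ (t : ℕ) (x : Ω), |(kop κ)^[t] g x - ∫ y, g y ∂π| ≤ 2 * Cg * (A * ρ ^ t))
    (hρ0 : 0 ≤ ρ) (hρ1 : ρ < 1)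
    {f : Ω → ℝ} (hf : Measurable f) {C : ℝ} (hC : ∀ x, |f x| ≤ C) :
    ((∫ y, (f y - ∫ z, f z ∂π) ^ 2 ∂π)
        + 2 * ∑' k, ∫ y, (f y - ∫ z, f z ∂π) * (kop κ)^[k + 1] (fun y => f y - ∫ z, f z ∂π) y ∂π = 0
      ∧ ∀ (μ₀ : Measure Ω) [IsProbabilityMeasure μ₀] (s n : ℕ),
        ∫ x, (∑ t ∈ Finset.range n, (f (x (s + t)) - ∫ z, f z ∂π)) ^ 2
          ∂(Kernel.trajMeasure (X := fun _ : ℕ => Ω) μ₀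
            (fun n : ℕ => κ.comap (fun h : (i : ↥(Finset.Iic n)) → Ω => h ⟨n, Finset.mem_Iic.2 le_rfl⟩)
              (measurable_pi_apply _)))
        ≤ 16 * C ^ 2 * A * (A * (1 + ρ) + 2 * ρ) / (1 - ρ) ^ 2)
    ∨ (0 < (∫ y, (f y - ∫ z, f z ∂π) ^ 2 ∂π)
        + 2 * ∑' k, ∫ y, (f y - ∫ z, f z ∂π) * (kop κ)^[k + 1] (fun y => f y - ∫ z, f z ∂π) y ∂π
      ∧ ∀ (μ₀ : Measure Ω) [IsProbabilityMeasure μ₀] (s : ℕ),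
        Tendsto (fun n : ℕ => ∫ x, (∑ t ∈ Finset.range n, (f (x (s + t)) - ∫ z, f z ∂π)) ^ 2
          ∂(Kernel.trajMeasure (X := fun _ : ℕ => Ω) μ₀
            (fun n : ℕ => κ.comap (fun h : (i : ↥(Finset.Iic n)) → Ω => h ⟨n, Finset.mem_Iic.2 le_rfl⟩)
              (measurable_pi_apply _)))) atTop atTop) := by
  rcases (greenKubo_nonneg_of_envelope hπ henv hρ0 hρ1 hf hC).eq_or_lt with h0 | hpos
  · exact Or.inl ⟨h0.symm, fun μ₀ _ s n =>
      chain_blockSum_sq_le_of_greenKubo_eq_zero_of_envelope henv hρ0 hρ1 hf hC h0.symm μ₀ s n⟩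
  · exact Or.inr ⟨hpos, fun μ₀ _ s =>
      tendsto_chain_blockSum_sq_atTop_of_greenKubo_pos henv hρ0 hρ1 hf hC hpos μ₀ s⟩

end Envelope

end Summit.Ventures.LatticeQCDFlow.Scoring

end
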